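import Summits.PneNP.PneNP.Theorems.KrwChromaticSteeringStrongCompositionDefs

/-!
# Route KrwChromaticSteering, crux `StrongComposition` (stmt-PneNP-18538) — registered stub `stub_residualRectangle`

Stub file for the birth skeleton `Summits/PneNP/PneNP/Cruxes/StrongComposition/Lines/birth.lean`
(planner-skel-stmt-PneNP-18538, sha d043782a…) of the crux C1
`Summit.PneNP.PneNP.Theses.KrwChromaticSteering.StrongComposition` (strong composition with `γ = 1`,
Meir 2023, arXiv:2306.00615).  It proves the registered stub

* **`stub_residualRectangle : ResidualRectangle`** (M, PRINTED — Meir 2023 §3.3, "the protocol obtained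
  by hard-wiring `g`"): at any bit string `π` with `|π| ≤ d`, for a tree `F g` of depth `≤ d` solving
  the strong game `KW_f ⊛ KW_g`, the RESIDUAL protocol of `F g` along `π`, fed with consistent witnesses
  of the live labels, solves `KW_f` on the live label rectangle `𝒜_π(g) × ℬ_π(g)` within the remaining
  depth: `∃ R, SolvesOn R (Aset f F π g) (Bset f F π g) ∧ |π| + depth R ≤ d`;

and, on the way, the elementary laws of the per-player consistency predicates `AliceConsistent` /
`BobConsistent` of the skeleton (objects in `…StrongCompositionDefs`, p546030), which the companion
stub file `…StrongCompositionChromaticEndgame.lean` (Meir's Lemma 8) reuses: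

* one-step laws at Alice / Bob nodes and leaves (`aliceConsistent_alice_cons`, …);
* `exists_residual_tree` — the subtree reached along `σ` runs like the whole tree on `σ`-consistent
  inputs and has depth `≤ d − |σ|`;
* `not_both_blocked` — reading the SAME tree, Alice and Bob are never both blocked at the next round;
* `aliceConsistent_extend` / `bobConsistent_extend` — a consistent string extends by one bit;
* `exists_leaf_of_aliceConsistent` — a full-length Alice-consistent string determines Alice's leaf;
* `exists_walk` — the joint walk of two DIFFERENT trees: a common consistent continuation of full
  length, or a shorter one ending in a conflict round.

Honest framing: this is the printed/easy part of the line; the lever `SteeredTranscript` (≡ C1 given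
the two printed stubs) is open, C1 is Meir's open problem, and nothing here bears on P vs NP.
-/

set_option linter.dupNamespace false -- `Summit.PneNP.PneNP.…`: summit = sub-problem name (D-0017 single-conjunct layout)
set_option autoImplicit false

namespace Summit.PneNP.PneNP.Theorems.KrwStrongComposition

open Literature.Computability.Complexity

universe u

/-! ### Reading a bit string down a tree: one-step laws of the consistency predicates -/

section Transcripts

variable {ι : Type u}

/-- The empty string is consistent for Alice with every tree. -/
@[simp] theorem aliceConsistent_nil (T : KWTree ι) (x : ι → Bool) : AliceConsistent T x [] := by
  cases T <;> exact trivial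

/-- The empty string is consistent for Bob with every tree. -/
@[simp] theorem bobConsistent_nil (T : KWTree ι) (y : ι → Bool) : BobConsistent T y [] := by
  cases T <;> exact trivial

/-- Past a leaf every string is consistent for Alice. -/
@[simp] theorem aliceConsistent_leaf (i : ι) (x : ι → Bool) (π : List Bool) :
    AliceConsistent (KWTree.leaf i) x π := by
  cases π <;> exact trivial

/-- Past a leaf every string is consistent for Bob. -/
@[simp] theorem bobConsistent_leaf (i : ι) (y : ι → Bool) (π : List Bool) :
    BobConsistent (KWTree.leaf i) y π := by
  cases π <;> exact trivial

/-- At an Alice node, Alice's string must start with the bit she sends, and continue consistently in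
the child it selects (`bif b then Q else P`). -/
theorem aliceConsistent_alice_cons (s : (ι → Bool) → Bool) (P Q : KWTree ι) (x : ι → Bool)
    (b : Bool) (π : List Bool) :
    AliceConsistent (KWTree.alice s P Q) x (b :: π) ↔
      s x = b ∧ AliceConsistent (bif b then Q else P) x π := by
  cases b <;> exact Iff.rfl

/-- At a Bob node, Alice receives any bit and continues in the child it selects. -/
theorem aliceConsistent_bob_cons (s : (ι → Bool) → Bool) (P Q : KWTree ι) (x : ι → Bool)
    (b : Bool) (π : List Bool) :
    AliceConsistent (KWTree.bob s P Q) x (b :: π) ↔ AliceConsistent (bif b then Q else P) x π := by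
  cases b <;> exact Iff.rfl

/-- At an Alice node, Bob receives any bit and continues in the child it selects. -/
theorem bobConsistent_alice_cons (s : (ι → Bool) → Bool) (P Q : KWTree ι) (y : ι → Bool)
    (b : Bool) (π : List Bool) :
    BobConsistent (KWTree.alice s P Q) y (b :: π) ↔ BobConsistent (bif b then Q else P) y π := by
  cases b <;> exact Iff.rfl

/-- At a Bob node, Bob's string must start with the bit he sends, and continue consistently in the
child it selects. -/
theorem bobConsistent_bob_cons (s : (ι → Bool) → Bool) (P Q : KWTree ι) (y : ι → Bool)
    (b : Bool) (π : List Bool) :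
    BobConsistent (KWTree.bob s P Q) y (b :: π) ↔
      s y = b ∧ BobConsistent (bif b then Q else P) y π := by
  cases b <;> exact Iff.rfl

/-- Run law at an Alice node, given the bit Alice sends. -/
theorem run_alice_of_eq {s : (ι → Bool) → Bool} {x : ι → Bool} {b : Bool} (h : s x = b)
    (P Q : KWTree ι) (y : ι → Bool) :
    (KWTree.alice s P Q).run x y = (bif b then Q else P).run x y := by
  cases b <;> simp [KWTree.run_alice, h]

/-- Run law at a Bob node, given the bit Bob sends. -/
theorem run_bob_of_eq {s : (ι → Bool) → Bool} {y : ι → Bool} {b : Bool} (h : s y = b)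
    (P Q : KWTree ι) (x : ι → Bool) :
    (KWTree.bob s P Q).run x y = (bif b then Q else P).run x y := by
  cases b <;> simp [KWTree.run_bob, h]

/-- The selected child is no deeper than the deeper child. -/
theorem depth_cond_le (b : Bool) (P Q : KWTree ι) :
    (bif b then Q else P).depth ≤ max P.depth Q.depth := by
  cases b
  · exact le_max_left _ _
  · exact le_max_right _ _

/-- **The residual protocol along a bit string.**  For every tree `T` of depth `≤ d` and every bit
string `σ` of length `≤ d` there is a tree `S` (the subtree of `T` reached along `σ`, or the leaf met
on the way) which, on every pair of inputs consistent with `σ` for the respective players, outputs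
what `T` outputs, and whose depth is at most `d − |σ|`. [cite: Meir2023, §3.3 (the residual protocol
after a partial transcript); folklore] -/
theorem exists_residual_tree :
    ∀ (σ : List Bool) (T : KWTree ι) (d : ℕ), T.depth ≤ d → σ.length ≤ d →
      ∃ S : KWTree ι,
        (∀ x y : ι → Bool, AliceConsistent T x σ → BobConsistent T y σ → S.run x y = T.run x y) ∧
          σ.length + S.depth ≤ d
  | [], T, d, hT, _ => ⟨T, fun _ _ _ _ => rfl, by simpa using hT⟩
  | b :: σ, KWTree.leaf i, d, _, hσ => ⟨KWTree.leaf i, fun _ _ _ _ => rfl, by simpa using hσ⟩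
  | b :: σ, KWTree.alice s P Q, d, hT, hσ => by
      have hchild : (bif b then Q else P).depth ≤ d - 1 := by
        have := depth_cond_le b P Q
        rw [KWTree.depth_alice] at hT
        omega
      have hσ' : σ.length ≤ d - 1 := by
        rw [List.length_cons] at hσ
        omega
      obtain ⟨S, hS, hSd⟩ := exists_residual_tree σ (bif b then Q else P) (d - 1) hchild hσ'
      refine ⟨S, fun x y hx hy => ?_, ?_⟩
      · rw [aliceConsistent_alice_cons] at hx
        rw [bobConsistent_alice_cons] at hy
        rw [hS x y hx.2 hy, run_alice_of_eq hx.1]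
      · rw [List.length_cons] at hσ ⊢
        omega
  | b :: σ, KWTree.bob s P Q, d, hT, hσ => by
      have hchild : (bif b then Q else P).depth ≤ d - 1 := by
        have := depth_cond_le b P Q
        rw [KWTree.depth_bob] at hT
        omega
      have hσ' : σ.length ≤ d - 1 := by
        rw [List.length_cons] at hσ
        omega
      obtain ⟨S, hS, hSd⟩ := exists_residual_tree σ (bif b then Q else P) (d - 1) hchild hσ'
      refine ⟨S, fun x y hx hy => ?_, ?_⟩
      · rw [aliceConsistent_bob_cons] at hx
        rw [bobConsistent_bob_cons] at hy
        rw [hS x y hx hy.2, run_bob_of_eq hy.1]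
      · rw [List.length_cons] at hσ ⊢
        omega

/-- **No conflict on the diagonal.**  If Alice (input `x`) and Bob (input `y`) read the SAME tree `T`
and both are consistent with `σ`, they cannot both be blocked at the next round: a failed one-bit
extension for Alice means the node after `σ` is an Alice node, for Bob a Bob node. [folklore] -/
theorem not_both_blocked :
    ∀ (σ : List Bool) (T : KWTree ι) (x y : ι → Bool) (b b' : Bool),
      AliceConsistent T x σ → BobConsistent T y σ →
        ¬ AliceConsistent T x (σ ++ [b]) → ¬ BobConsistent T y (σ ++ [b']) → False
  | [], KWTree.leaf i, x, y, b, b', _, _, hA, _ => hA (aliceConsistent_leaf i x _)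
  | [], KWTree.alice s P Q, x, y, b, b', _, _, _, hB => by
      rw [List.nil_append, bobConsistent_alice_cons] at hB
      exact hB (bobConsistent_nil _ y)
  | [], KWTree.bob s P Q, x, y, b, b', _, _, hA, _ => by
      rw [List.nil_append, aliceConsistent_bob_cons] at hA
      exact hA (aliceConsistent_nil _ x)
  | a :: σ, KWTree.leaf i, x, y, b, b', _, _, hA, _ => hA (aliceConsistent_leaf i x _)
  | a :: σ, KWTree.alice s P Q, x, y, b, b', hAσ, hBσ, hA, hB => by
      rw [aliceConsistent_alice_cons] at hAσ
      rw [bobConsistent_alice_cons] at hBσ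
      rw [List.cons_append, aliceConsistent_alice_cons] at hA
      rw [List.cons_append, bobConsistent_alice_cons] at hB
      exact not_both_blocked σ (bif a then Q else P) x y b b' hAσ.2 hBσ
        (fun h => hA ⟨hAσ.1, h⟩) hB
  | a :: σ, KWTree.bob s P Q, x, y, b, b', hAσ, hBσ, hA, hB => by
      rw [aliceConsistent_bob_cons] at hAσ
      rw [bobConsistent_bob_cons] at hBσ
      rw [List.cons_append, aliceConsistent_bob_cons] at hA
      rw [List.cons_append, bobConsistent_bob_cons] at hB
      exact not_both_blocked σ (bif a then Q else P) x y b b' hAσ hBσ.2 hA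
        (fun h => hB ⟨hBσ.1, h⟩)

/-- Alice can always extend a consistent string by one bit (the bit she sends, if it is her node). -/
theorem aliceConsistent_extend :
    ∀ (σ : List Bool) (T : KWTree ι) (x : ι → Bool),
      AliceConsistent T x σ → ∃ b, AliceConsistent T x (σ ++ [b])
  | [], KWTree.leaf i, x, _ => ⟨false, aliceConsistent_leaf i x _⟩
  | [], KWTree.alice s P Q, x, _ => ⟨s x, by
      rw [List.nil_append, aliceConsistent_alice_cons]
      exact ⟨rfl, aliceConsistent_nil _ x⟩⟩
  | [], KWTree.bob s P Q, x, _ => ⟨false, by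
      rw [List.nil_append, aliceConsistent_bob_cons]
      exact aliceConsistent_nil _ x⟩
  | a :: σ, KWTree.leaf i, x, _ => ⟨false, aliceConsistent_leaf i x _⟩
  | a :: σ, KWTree.alice s P Q, x, h => by
      rw [aliceConsistent_alice_cons] at h
      obtain ⟨b, hb⟩ := aliceConsistent_extend σ (bif a then Q else P) x h.2
      exact ⟨b, by rw [List.cons_append, aliceConsistent_alice_cons]; exact ⟨h.1, hb⟩⟩
  | a :: σ, KWTree.bob s P Q, x, h => by
      rw [aliceConsistent_bob_cons] at h
      obtain ⟨b, hb⟩ := aliceConsistent_extend σ (bif a then Q else P) x h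
      exact ⟨b, by rw [List.cons_append, aliceConsistent_bob_cons]; exact hb⟩

/-- Bob can always extend a consistent string by one bit. -/
theorem bobConsistent_extend :
    ∀ (σ : List Bool) (T : KWTree ι) (y : ι → Bool),
      BobConsistent T y σ → ∃ b, BobConsistent T y (σ ++ [b])
  | [], KWTree.leaf i, y, _ => ⟨false, bobConsistent_leaf i y _⟩
  | [], KWTree.alice s P Q, y, _ => ⟨false, by
      rw [List.nil_append, bobConsistent_alice_cons]
      exact bobConsistent_nil _ y⟩
  | [], KWTree.bob s P Q, y, _ => ⟨s y, by
      rw [List.nil_append, bobConsistent_bob_cons]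
      exact ⟨rfl, bobConsistent_nil _ y⟩⟩
  | a :: σ, KWTree.leaf i, y, _ => ⟨false, bobConsistent_leaf i y _⟩
  | a :: σ, KWTree.alice s P Q, y, h => by
      rw [bobConsistent_alice_cons] at h
      obtain ⟨b, hb⟩ := bobConsistent_extend σ (bif a then Q else P) y h
      exact ⟨b, by rw [List.cons_append, bobConsistent_alice_cons]; exact hb⟩
  | a :: σ, KWTree.bob s P Q, y, h => by
      rw [bobConsistent_bob_cons] at h
      obtain ⟨b, hb⟩ := bobConsistent_extend σ (bif a then Q else P) y h.2
      exact ⟨b, by rw [List.cons_append, bobConsistent_bob_cons]; exact ⟨h.1, hb⟩⟩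

/-- **A full-length consistent string determines Alice's leaf.**  If Alice's input `x` is consistent
with `σ` and `|σ| ≥ depth T`, the leaf reached is the same against every Bob input consistent with
`σ`. [folklore] -/
theorem exists_leaf_of_aliceConsistent :
    ∀ (σ : List Bool) (T : KWTree ι) (x : ι → Bool),
      AliceConsistent T x σ → T.depth ≤ σ.length →
        ∃ ℓ : ι, ∀ y : ι → Bool, BobConsistent T y σ → T.run x y = ℓ
  | _, KWTree.leaf i, x, _, _ => ⟨i, fun _ _ => rfl⟩
  | [], KWTree.alice s P Q, x, _, hd => by simp at hd
  | [], KWTree.bob s P Q, x, _, hd => by simp at hd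
  | a :: σ, KWTree.alice s P Q, x, h, hd => by
      rw [aliceConsistent_alice_cons] at h
      have hd' : (bif a then Q else P).depth ≤ σ.length := by
        have := depth_cond_le a P Q
        rw [KWTree.depth_alice, List.length_cons] at hd
        omega
      obtain ⟨ℓ, hℓ⟩ := exists_leaf_of_aliceConsistent σ (bif a then Q else P) x h.2 hd'
      refine ⟨ℓ, fun y hy => ?_⟩
      rw [bobConsistent_alice_cons] at hy
      rw [run_alice_of_eq h.1, hℓ y hy]
  | a :: σ, KWTree.bob s P Q, x, h, hd => by
      rw [aliceConsistent_bob_cons] at h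
      have hd' : (bif a then Q else P).depth ≤ σ.length := by
        have := depth_cond_le a P Q
        rw [KWTree.depth_bob, List.length_cons] at hd
        omega
      obtain ⟨ℓ, hℓ⟩ := exists_leaf_of_aliceConsistent σ (bif a then Q else P) x h hd'
      refine ⟨ℓ, fun y hy => ?_⟩
      rw [bobConsistent_bob_cons] at hy
      rw [run_bob_of_eq hy.1, hℓ y hy.2]

/-- **The two-tree walk.**  Alice reads `TA` on `x`, Bob reads `TB` on `y`; starting from a string `π`
consistent for both, after `k` more rounds either there is a continuation `σ` of length exactly `k`
consistent for both, or a shorter one followed by a CONFLICT round (a one-bit extension fails for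
Alice on `TA` and one fails for Bob on `TB`: Alice is at an Alice node of her tree while Bob is at a
Bob node of his). [cite: Meir2023, §4.2 (proof of Lemma 8: classical rounds vs. the first
non-classical round); folklore] -/
theorem exists_walk (TA TB : KWTree ι) (x y : ι → Bool) (π : List Bool)
    (hA : AliceConsistent TA x π) (hB : BobConsistent TB y π) :
    ∀ k : ℕ, ∃ σ : List Bool, AliceConsistent TA x (π ++ σ) ∧ BobConsistent TB y (π ++ σ) ∧
      (σ.length = k ∨ (σ.length < k ∧ ∃ b b',
        ¬ AliceConsistent TA x (π ++ σ ++ [b]) ∧ ¬ BobConsistent TB y (π ++ σ ++ [b'])))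
  | 0 => ⟨[], by simpa using hA, by simpa using hB, Or.inl rfl⟩
  | k + 1 => by
      obtain ⟨σ, hAσ, hBσ, hcase⟩ := exists_walk TA TB x y π hA hB k
      rcases hcase with hlen | ⟨hlt, hconf⟩
      · obtain ⟨b₀, hb₀⟩ := aliceConsistent_extend (π ++ σ) TA x hAσ
        obtain ⟨b₁, hb₁⟩ := bobConsistent_extend (π ++ σ) TB y hBσ
        by_cases hA₁ : AliceConsistent TA x (π ++ σ ++ [b₁])
        · refine ⟨σ ++ [b₁], ?_, ?_, Or.inl (by simp [hlen])⟩
          · rw [← List.append_assoc]; exact hA₁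
          · rw [← List.append_assoc]; exact hb₁
        · by_cases hB₀ : BobConsistent TB y (π ++ σ ++ [b₀])
          · refine ⟨σ ++ [b₀], ?_, ?_, Or.inl (by simp [hlen])⟩
            · rw [← List.append_assoc]; exact hb₀
            · rw [← List.append_assoc]; exact hB₀
          · exact ⟨σ, hAσ, hBσ, Or.inr ⟨by omega, b₁, b₀, hA₁, hB₀⟩⟩
      · exact ⟨σ, hAσ, hBσ, Or.inr ⟨by omega, hconf⟩⟩

end Transcripts

/-! ### The registered stub `stub_residualRectangle` -/

/-- **Registered stub `stub_residualRectangle` of the birth skeleton of `StrongComposition`** (Meir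
2023 §3.3, "the protocol obtained by hard-wiring `g`"; M-sized, PRINTED): at any bit string `π` with
`|π| ≤ d`, for a tree `F g` of depth `≤ d` solving `KW_f ⊛ KW_g`, the residual protocol — the subtree
of `F g` reached along `π` (`exists_residual_tree`), fed with chosen consistent witnesses
`X_a ∈ 𝒳_π(g)` of `a ∈ 𝒜_π(g)` and `Y_b ∈ 𝒴_π(g)` of `b ∈ ℬ_π(g)` (a `comap` reporting the ROW of the
answer) — solves `KW_f` on the live label rectangle `𝒜_π(g) × ℬ_π(g)` (by `SolvesStrong` the answer's
row has differing labels `a_i ≠ b_i`), within the remaining depth: `|π| + depth R ≤ d`.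
[cite: Meir2023, §3.3, Def. 12] -/
theorem stub_residualRectangle :
    ∀ (m n : ℕ) (f : (Fin m → Bool) → Bool) (F : Family m n) (d : ℕ) (π : List Bool)
      (g : (Fin n → Bool) → Bool),
      (F g).SolvesStrong f g → (F g).depth ≤ d → π.length ≤ d →
        ∃ R : KWTree (Fin m), SolvesOn R (Aset f F π g) (Bset f F π g) ∧ π.length + R.depth ≤ d := by
  intro m n f F d π g hS hdepth hπ
  classical
  obtain ⟨S, hSrun, hSd⟩ := exists_residual_tree π (F g) d hdepth hπ
  -- chosen consistent witnesses of the live labels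
  have hA : ∀ a ∈ Aset f F π g, ∃ X ∈ Xset f F π g, rowLabels g X = a := fun a ha => by
    simpa only [Aset, Set.mem_image] using ha
  have hB : ∀ b ∈ Bset f F π g, ∃ Y ∈ Yset f F π g, rowLabels g Y = b := fun b hb => by
    simpa only [Bset, Set.mem_image] using hb
  choose! wX hwX hwXa using hA
  choose! wY hwY hwYb using hB
  refine ⟨S.comap wX wY Prod.fst, fun a ha b hb => ?_, by simpa using hSd⟩
  obtain ⟨hXa, hXc⟩ := hwX a ha
  obtain ⟨hYb, hYc⟩ := hwY b hb
  have hsol := (hS (wX a) (wY b) hXa hYb).2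
  rw [hwXa a ha, hwYb b hb] at hsol
  rw [KWTree.run_comap, hSrun (wX a) (wY b) hXc hYc]
  exact hsol

end Summit.PneNP.PneNP.Theorems.KrwStrongComposition
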